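import Summits.Ventures.QEC.Census.CertCoverBatch
import Summits.Ventures.QEC.Census.BB.A1s_n192_k4_0fa3ae82.CoreDefs
import HarnessLib

set_option Elab.async false
set_option maxRecDepth 200000

/-!
# `[[192,4,18]]` one-level cover certificate — LEVEL-1→0 coset problems 351…360 (problem 1 excluded: `Prob1.lean`) as COMPACT data
(`ProbData`: U, f, σ, y₀, allow; qec-type-10 `CertCoverBatch.mkCoset` rebuilds each `CosetProb` in the kernel) + their verdict
`probsOK cov covR hx hx1 D1 lxd 16` (one `decide +kernel`). qec-search-9 g5 (lead block 170 (0)(c)); data from JSON `level10.problems`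
(sha256 08367568…). Data + decided check; KERNEL.
-/

namespace Summit.Ventures.QEC.Census.A1s_n192_k4_0fa3ae82

open Matrix Summit.Ventures.QEC.Census Literature.InformationTheory.QuantumCodes

/-- Problems 351…360 (10): `⟨U, f, σ, y₀, allow⟩`. -/
def probs07a : List ProbData := [
    ⟨1818111312641121000163584, 2, 0, 0, [0]⟩,
    ⟨1818111385547529526444570, 0, 6597071470592, 1818111097312755327173146, [0]⟩,
    ⟨1818111457882191803128064, 1, 0, 0, [0, 17179869184, 144115188075855872]⟩,
    ⟨1818111529376827297632512, 3, 0, 0, [0, 17179869184]⟩,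
    ⟨1818111637744697626236160, 0, 0, 0, [0]⟩,
    ⟨1818111819859037623038208, 1, 0, 0, [0, 17179869184, 288230376151711744]⟩,
    ⟨1818111962848342971785472, 2, 0, 0, [0]⟩,
    ⟨1818112543812763622596864, 0, 0, 0, [0]⟩,
    ⟨1818112829791305600614656, 2, 0, 0, [0]⟩,
    ⟨1818113263262752555290880, 0, 0, 0, [0]⟩]

set_option maxHeartbeats 400000000 in
/-- Every problem of this chunk passes (`mkCoset` elimination + `cosetOKD` + fast `σ` + depth + `BU`-evenness + label checks). -/
theorem probs07a_ok : probsOK cov covR hx hx1 D1 lxd 16 probs07a = true := by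
  decide +kernel

/-- Pointwise form. -/
theorem probs07a_all : ∀ x ∈ probs07a, probOK cov covR hx hx1 D1 lxd 16 x = true := by
  have h := probs07a_ok
  rwa [probsOK, List.all_eq_true] at h

end Summit.Ventures.QEC.Census.A1s_n192_k4_0fa3ae82
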